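import Literature.Analysis.FunctionSpaces.PlancherelL1L2
import Mathlib.Analysis.Fourier.Convolution
import Mathlib.Analysis.SpecialFunctions.Integrals.Basic
import Mathlib.Analysis.Calculus.BumpFunction.FiniteDimension
import Mathlib.Analysis.SpecialFunctions.Trigonometric.Bounds
import Mathlib.Analysis.SpecialFunctions.ImproperIntegrals
import Mathlib.MeasureTheory.Measure.Lebesgue.Integral
import Mathlib.Analysis.Real.Pi.Bounds
import HarnessLib

/-!
# Window sums of Dirichlet polynomials in logarithmic scale: a Plancherel toolkit

Topic `NumberTheory/LFunctions` (companion of `DirichletPolynomialMeanValue.lean`).  This file is the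
harmonic-analysis half of a proof of **Lemma 14 of Matomäki–Radziwiłł** (Ann. of Math. 183 (2016),
§7, "Parseval bound"; the named fact `Literature.NumberTheory.Sieve.MatomakiRadziwill2016_lemma14_real` of
`Literature/NumberTheory/Sieve/MatomakiRadziwill.lean`), which bounds the mean square of
`h₁⁻¹ ∑_{x ≤ m ≤ x+h₁} a_m - h₂⁻¹ ∑_{x ≤ m ≤ x+h₂} a_m` over `x ∈ [X, 2X]` by mean values of the
Dirichlet polynomial `A(1+it) = ∑ a_m m^{-1-it}` over `|t| ≥ (log X)^{1/15}`.  The paper argues with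
Perron's formula (a conditionally convergent line integral), splits it at height `T₀`, and treats the
tail by a smoothing and an exchange of integrations.  Here the same mechanism is set up with
absolutely convergent objects only, so that Mathlib's Fourier analysis applies verbatim:

* In the variable `v = log x` a *multiplicative* window sum `∑_{e^v < m ≤ e^{v+θ}} b_m` is the function
  `logWindow s b θ` (`W_θ`), a finite combination of indicators; its Fourier transform is
  `κ_θ(ξ) A(ξ)` with `A(ξ) = ∑ b_m e(-ξ log m)` (`dirichletSum`, i.e. `∑ b_m m^{-it}` at `t = 2πξ`) and
  `κ_θ(ξ) = ∫_0^θ e(ξu) du` (`windowTransform`), `|κ_θ| ≤ min(θ, 1/(π|ξ|))` (`fourier_logWindow`,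
  `norm_windowTransform_le`, `norm_windowTransform_le_inv`).
* The split at `|ξ| ≈ τ` is performed by a smooth even cutoff `χ` (`cutoff`, a `ContDiffBump`, `= 1` on
  `|ξ| ≤ τ'`, `= 0` for `|ξ| ≥ 2τ'`, `τ' = max τ 1`) through its Schwartz kernel `φ = 𝓕⁻¹χ`
  (`lowPassKernel`): `W_θ = L_θ + H_θ` with `L_θ = φ ⋆ W_θ` (`lowPart`) and `H_θ = W_θ - φ ⋆ W_θ`
  (`highPart`), `𝓕 H_θ = (1 - χ) κ_θ A` (`fourier_highPart`, Mathlib's convolution theorem).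
* **Low part** (the paper's `U_j`): `L_θ(v) = θ Ψ(v) + O(τ'² θ² ∑|b_m|)` with `Ψ = ∑ b_m φ(· - log m)`
  independent of `θ` (`norm_lowPart_sub_le`; `φ` is bounded by `4τ'` and `16πτ'²`-Lipschitz,
  `norm_lowPassKernel_le`, `norm_lowPassKernel_sub_le`), and `Ψ` is `16πτ'²∑|b_m|`-Lipschitz
  (`norm_lowPassMain_sub_le`).  This linearity in `θ` is what makes the two windows `h₁, h₂` cancel.
* **High part** (the paper's `V_j`): by Plancherel on `L¹ ∩ L²`
  (`Literature.Analysis.FunctionSpaces.integral_norm_sq_fourierIntegral_eq`) and the bounds on `κ_θ`, for `0 ≤ θ ≤ Θ`,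
  `∫ |H_θ(v)|² dv ≤ 2 ∫_{ξ > τ'} min(Θ², 1/(π²ξ²)) |A(ξ)|² dξ` (`integral_norm_sq_highPart_le`); the
  symmetry `|A(-ξ)| = |A(ξ)|` used here (`norm_dirichletSum_neg`) is exactly where the coefficients
  must be **real**.
* Joint measurability of `(θ, v) ↦ H_θ(v)` (`measurable_uncurry_highPart`) and the uniform bound
  `norm_highPart_le`, for the Tonelli step of the assembly.

The assembly (the Saffari–Vaughan-type averaging over the window length, Cauchy–Schwarz, Tonelli and
the bookkeeping of Lemma 14) is in `Literature/NumberTheory/Sieve/MatomakiRadziwillLemma14.lean`.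

## References

* K. Matomäki, M. Radziwiłł, *Multiplicative functions in short intervals*, Ann. of Math. (2) 183
  (2016), 1015–1056, doi:10.4007/annals.2016.183.3.6 (arXiv:1501.04585), §7, Lemma 14 and its proof.
* E. C. Titchmarsh, *Introduction to the Theory of Fourier Integrals*, 2nd ed., Oxford 1948, Thm. 48
  (Plancherel) — via `Literature/Analysis/FunctionSpaces/PlancherelL1L2.lean`.

## Mathlib

`Real.fourier_mul_convolution_eq` (convolution theorem), `SchwartzMap` Fourier inversion
(`FourierTransform.fourier_fourierInv_eq`), `ContDiffBump`, `HasCompactSupport.toSchwartzMap`,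
`integral_exp_mul_complex`, `integral_comp_abs`, `integrable_inv_one_add_sq`.
-/

noncomputable section

open MeasureTheory Real Complex Finset Set Filter FourierTransform
open scoped Convolution

namespace Literature.NumberTheory.LFunctions.WindowPlancherel


/-- The **window sum in logarithmic scale**: `W_θ(v) = ∑_{m ∈ s} b_m 1[log m - θ ≤ v < log m]`,
i.e. `∑ b_m` over `e^v < m ≤ e^{v+θ}` — the multiplicative window `(y, y e^θ]` at `y = e^v`. [folklore] -/
def logWindow (s : Finset ℕ) (b : ℕ → ℝ) (θ : ℝ) (v : ℝ) : ℂ :=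
  ∑ m ∈ s, (b m : ℂ) * (Set.Ico (Real.log m - θ) (Real.log m)).indicator 1 v

/-- The Fourier multiplier of the window: `κ_θ(ξ) = ∫_0^θ e(ξ u) du` (so that
`𝓕 1_{[c-θ,c)}(ξ) = e(-ξc) κ_θ(ξ)`); `|κ_θ(ξ)| ≤ min(θ, 1/(π|ξ|))`. [folklore] -/
def windowTransform (θ ξ : ℝ) : ℂ := ∫ u in (0 : ℝ)..θ, Complex.exp (↑(2 * π * (ξ * u)) * Complex.I)

/-- The Dirichlet polynomial in Fourier normalisation, `A(ξ) = ∑_{m ∈ s} b_m e(-ξ log m)`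
(`= ∑ b_m m^{-it}` at `t = 2πξ`). [folklore] -/
def dirichletSum (s : Finset ℕ) (b : ℕ → ℝ) (ξ : ℝ) : ℂ :=
  ∑ m ∈ s, (b m : ℂ) * Complex.exp (↑(-2 * π * (ξ * Real.log m)) * Complex.I)

/-- `W(v)` is the sum of `b_m` over the `m ∈ s` with `log m - θ ≤ v < log m`. [folklore] -/
theorem logWindow_apply (s : Finset ℕ) (b : ℕ → ℝ) (θ v : ℝ) :
    logWindow s b θ v = ∑ m ∈ s.filter (fun m : ℕ => Real.log m - θ ≤ v ∧ v < Real.log m), (b m : ℂ) := by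
  rw [logWindow, Finset.sum_filter]
  refine Finset.sum_congr rfl fun m _ => ?_
  by_cases h : Real.log (m : ℝ) - θ ≤ v ∧ v < Real.log m
  · rw [if_pos h, Set.indicator_of_mem (by exact h), Pi.one_apply, mul_one]
  · rw [if_neg h, Set.indicator_of_notMem (by exact h), mul_zero]

/-- `‖W(v)‖ ≤ ∑ |b_m|`. [folklore] -/
theorem norm_logWindow_le (s : Finset ℕ) (b : ℕ → ℝ) (θ v : ℝ) :
    ‖logWindow s b θ v‖ ≤ ∑ m ∈ s, |b m| := by
  unfold logWindow
  refine (norm_sum_le _ _).trans (Finset.sum_le_sum fun m _ => ?_)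
  rw [norm_mul, Complex.norm_real, Real.norm_eq_abs]
  refine mul_le_of_le_one_right (abs_nonneg _) ?_
  by_cases h : v ∈ Set.Ico (Real.log m - θ) (Real.log m)
  · simp [Set.indicator_of_mem h]
  · simp [Set.indicator_of_notMem h]

/-- Fourier transform of one window indicator: `𝓕 1_{[c-θ, c)}(ξ) = e(-ξ c) κ_θ(ξ)`. [folklore] -/
theorem fourier_indicator_Ico (c θ ξ : ℝ) (hθ : 0 ≤ θ) :
    𝓕 (fun v : ℝ => ((Set.Ico (c - θ) c).indicator (1 : ℝ → ℂ) v)) ξ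
      = Complex.exp (↑(-2 * π * (ξ * c)) * Complex.I) * windowTransform θ ξ := by
  rw [Real.fourier_real_eq_integral_exp_smul]
  simp_rw [smul_eq_mul]
  have : ∀ v : ℝ, Complex.exp (↑(-2 * π * v * ξ) * Complex.I) * (Set.Ico (c - θ) c).indicator 1 v
      = (Set.Ico (c - θ) c).indicator (fun v => Complex.exp (↑(-2 * π * v * ξ) * Complex.I)) v := by
    intro v
    by_cases h : v ∈ Set.Ico (c - θ) c
    · simp [Set.indicator_of_mem h]
    · simp [Set.indicator_of_notMem h]
  simp_rw [this]
  rw [MeasureTheory.integral_indicator measurableSet_Ico, MeasureTheory.integral_Ico_eq_integral_Ioc,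
    ← intervalIntegral.integral_of_le (by linarith), windowTransform]
  -- substitute v = c - u
  have hsub := intervalIntegral.integral_comp_sub_left
    (fun v => Complex.exp (↑(-2 * π * v * ξ) * Complex.I)) c (a := 0) (b := θ)
  rw [sub_zero] at hsub
  rw [← hsub, ← intervalIntegral.integral_const_mul]
  refine intervalIntegral.integral_congr fun u _ => ?_
  rw [← Complex.exp_add]
  congr 1
  push_cast
  ring


/-- The indicator of a bounded interval is integrable. [folklore] -/
theorem integrable_indicator_Ico_one (c θ : ℝ) :
    Integrable (fun v : ℝ => (Set.Ico (c - θ) c).indicator (1 : ℝ → ℂ) v) := by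
  refine IntegrableOn.integrable_indicator ?_ measurableSet_Ico
  exact integrableOn_const (by rw [Real.volume_Ico]; exact ENNReal.ofReal_lt_top |>.ne)

/-- `W` is integrable (a finite combination of indicators of bounded intervals). [folklore] -/
theorem integrable_logWindow (s : Finset ℕ) (b : ℕ → ℝ) (θ : ℝ) : Integrable (logWindow s b θ) := by
  unfold logWindow
  refine integrable_finsetSum _ fun m _ => ?_
  exact (integrable_indicator_Ico_one _ _).const_mul _

/-- `W` is measurable. [folklore] -/
theorem measurable_logWindow (s : Finset ℕ) (b : ℕ → ℝ) (θ : ℝ) : Measurable (logWindow s b θ) := by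
  unfold logWindow
  refine Finset.measurable_sum _ fun m _ => ?_
  exact ((measurable_const.indicator measurableSet_Ico)).const_mul _

/-- A bounded integrable function is square integrable. [folklore] -/
theorem memLp_two_of_norm_le {f : ℝ → ℂ} (hf : Integrable f) {M : ℝ}
    (hM : ∀ v, ‖f v‖ ≤ M) : MemLp f 2 := by
  rw [memLp_two_iff_integrable_sq_norm hf.aestronglyMeasurable]
  refine (hf.norm.const_mul M).mono' (hf.aestronglyMeasurable.norm.pow 2) ?_
  refine Eventually.of_forall fun v => ?_
  rw [Real.norm_eq_abs, abs_of_nonneg (sq_nonneg _), sq]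
  exact mul_le_mul_of_nonneg_right (hM v) (norm_nonneg _)

/-- `W ∈ L²`. [folklore] -/
theorem memLp_two_logWindow (s : Finset ℕ) (b : ℕ → ℝ) (θ : ℝ) : MemLp (logWindow s b θ) 2 :=
  memLp_two_of_norm_le (integrable_logWindow s b θ) (norm_logWindow_le s b θ)

/-- The Fourier phase `v ↦ e(-v ξ)` times an integrable function is integrable. [folklore] -/
theorem integrable_cexp_mul {f : ℝ → ℂ} (hf : Integrable f) (ξ : ℝ) :
    Integrable (fun v : ℝ => Complex.exp (↑(-2 * π * v * ξ) * Complex.I) * f v) := by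
  refine hf.bdd_mul (c := 1) (Continuous.aestronglyMeasurable (by fun_prop)) ?_
  refine Eventually.of_forall fun v => ?_
  rw [Complex.norm_exp_ofReal_mul_I]

/-- **Fourier transform of the window sum**: `𝓕 W(ξ) = κ_θ(ξ) · ∑ b_m e(-ξ log m)`. [folklore] -/
theorem fourier_logWindow (s : Finset ℕ) (b : ℕ → ℝ) {θ : ℝ} (hθ : 0 ≤ θ) (ξ : ℝ) :
    𝓕 (logWindow s b θ) ξ = windowTransform θ ξ * dirichletSum s b ξ := by
  have key : 𝓕 (logWindow s b θ) ξ = ∑ m ∈ s, (b m : ℂ) *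
      𝓕 (fun v : ℝ => (Set.Ico (Real.log m - θ) (Real.log m)).indicator (1 : ℝ → ℂ) v) ξ := by
    simp only [Real.fourier_real_eq_integral_exp_smul, smul_eq_mul]
    calc ∫ v : ℝ, Complex.exp (↑(-2 * π * v * ξ) * Complex.I) * logWindow s b θ v
        = ∫ v : ℝ, ∑ m ∈ s, (b m : ℂ) * (Complex.exp (↑(-2 * π * v * ξ) * Complex.I)
            * (Set.Ico (Real.log m - θ) (Real.log m)).indicator (1 : ℝ → ℂ) v) := by
          refine integral_congr_ae (Eventually.of_forall fun v => ?_)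
          simp only [logWindow, Finset.mul_sum]
          exact Finset.sum_congr rfl fun m _ => by ring
      _ = ∑ m ∈ s, ∫ v : ℝ, (b m : ℂ) * (Complex.exp (↑(-2 * π * v * ξ) * Complex.I)
            * (Set.Ico (Real.log m - θ) (Real.log m)).indicator (1 : ℝ → ℂ) v) := by
          refine integral_finsetSum _ fun m _ => ?_
          exact (integrable_cexp_mul (integrable_indicator_Ico_one _ _) ξ).const_mul _
      _ = _ := Finset.sum_congr rfl fun m _ => integral_const_mul _ _
  rw [key, dirichletSum, Finset.mul_sum]
  refine Finset.sum_congr rfl fun m _ => ?_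
  rw [fourier_indicator_Ico _ _ _ hθ]
  ring

/-- `|κ_θ(ξ)| ≤ θ`. [folklore] -/
theorem norm_windowTransform_le (ξ : ℝ) {θ : ℝ} (hθ : 0 ≤ θ) : ‖windowTransform θ ξ‖ ≤ θ := by
  unfold windowTransform
  have := intervalIntegral.norm_integral_le_of_norm_le_const (a := 0) (b := θ) (C := 1)
    (f := fun u : ℝ => Complex.exp (↑(2 * π * (ξ * u)) * Complex.I)) (fun u _ => ?_)
  · simpa [abs_of_nonneg hθ] using this
  · rw [Complex.norm_exp_ofReal_mul_I]

/-- Closed form `κ_θ(ξ) = (e(ξθ) - 1)/(2πiξ)` for `ξ ≠ 0`. [folklore] -/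
theorem windowTransform_eq_of_ne_zero (θ : ℝ) {ξ : ℝ} (hξ : ξ ≠ 0) :
    windowTransform θ ξ = (Complex.exp (↑(2 * π * (ξ * θ)) * Complex.I) - 1) / (2 * π * ξ * Complex.I) := by
  unfold windowTransform
  have hc : (2 * π * ξ * Complex.I : ℂ) ≠ 0 := by
    simp [hξ, Real.pi_ne_zero, Complex.I_ne_zero]
  have := integral_exp_mul_complex (a := 0) (b := θ) hc
  simp only [Complex.ofReal_zero, mul_zero, Complex.exp_zero] at this
  have e1 : ∀ u : ℝ, Complex.exp (↑(2 * π * (ξ * u)) * Complex.I)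
      = Complex.exp (2 * π * ξ * Complex.I * u) := fun u => by
    congr 1; push_cast; ring
  simp_rw [e1]
  rw [this, ← e1 θ]

/-- `|κ_θ(ξ)| ≤ 1/(π|ξ|)` for `ξ ≠ 0`. [folklore] -/
theorem norm_windowTransform_le_inv (θ : ℝ) {ξ : ℝ} (hξ : ξ ≠ 0) : ‖windowTransform θ ξ‖ ≤ 1 / (π * |ξ|) := by
  rw [windowTransform_eq_of_ne_zero θ hξ, norm_div]
  have h1 : ‖Complex.exp (↑(2 * π * (ξ * θ)) * Complex.I) - 1‖ ≤ 2 := by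
    refine (norm_sub_le _ _).trans ?_
    rw [Complex.norm_exp_ofReal_mul_I, norm_one]; norm_num
  have h2 : ‖(2 * π * ξ * Complex.I : ℂ)‖ = 2 * π * |ξ| := by
    rw [norm_mul, Complex.norm_I, mul_one, norm_mul, norm_mul, Complex.norm_real,
      Complex.norm_real, Complex.norm_ofNat, Real.norm_eq_abs, Real.norm_eq_abs,
      abs_of_pos Real.pi_pos]
  rw [h2, div_le_div_iff₀ (by positivity) (by positivity), one_mul]
  calc ‖Complex.exp (↑(2 * π * (ξ * θ)) * Complex.I) - 1‖ * (π * |ξ|) ≤ 2 * (π * |ξ|) :=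
        mul_le_mul_of_nonneg_right h1 (by positivity)
    _ = 2 * π * |ξ| := by ring

/-- For real coefficients `A(-ξ) = conj A(ξ)`. [folklore] -/
theorem dirichletSum_neg (s : Finset ℕ) (b : ℕ → ℝ) (ξ : ℝ) :
    dirichletSum s b (-ξ) = (starRingEnd ℂ) (dirichletSum s b ξ) := by
  unfold dirichletSum
  rw [map_sum]
  refine Finset.sum_congr rfl fun m _ => ?_
  rw [map_mul, Complex.conj_ofReal, ← Complex.exp_conj, map_mul, Complex.conj_I,
    Complex.conj_ofReal]
  congr 1
  push_cast
  ring

/-- For real coefficients `|A(-ξ)| = |A(ξ)|` (the symmetry that makes the one-sided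
statement of Matomäki–Radziwiłł's Lemma 14 correct for real sequences). [folklore] -/
theorem norm_dirichletSum_neg (s : Finset ℕ) (b : ℕ → ℝ) (ξ : ℝ) :
    ‖dirichletSum s b (-ξ)‖ = ‖dirichletSum s b ξ‖ := by
  rw [dirichletSum_neg, Complex.norm_conj]

/-- `κ_θ(-ξ) = conj κ_θ(ξ)`. [folklore] -/
theorem windowTransform_neg (θ ξ : ℝ) : windowTransform θ (-ξ) = (starRingEnd ℂ) (windowTransform θ ξ) := by
  unfold windowTransform
  simp only [intervalIntegral, map_sub, ← integral_conj]
  have h : ∀ u : ℝ, Complex.exp (↑(2 * π * (-ξ * u)) * Complex.I)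
      = (starRingEnd ℂ) (Complex.exp (↑(2 * π * (ξ * u)) * Complex.I)) := by
    intro u
    rw [← Complex.exp_conj, map_mul, Complex.conj_I, Complex.conj_ofReal]
    congr 1
    push_cast
    ring
  simp_rw [h]

/-- `|κ_θ(-ξ)| = |κ_θ(ξ)|`. [folklore] -/
theorem norm_windowTransform_neg (θ ξ : ℝ) : ‖windowTransform θ (-ξ)‖ = ‖windowTransform θ ξ‖ := by
  rw [windowTransform_neg, Complex.norm_conj]

/-- `|A(ξ)| ≤ ∑ |b_m|`. [folklore] -/
theorem norm_dirichletSum_le (s : Finset ℕ) (b : ℕ → ℝ) (ξ : ℝ) :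
    ‖dirichletSum s b ξ‖ ≤ ∑ m ∈ s, |b m| := by
  unfold dirichletSum
  refine (norm_sum_le _ _).trans (Finset.sum_le_sum fun m _ => ?_)
  rw [norm_mul, Complex.norm_real, Real.norm_eq_abs, Complex.norm_exp_ofReal_mul_I, mul_one]

/-- `A` is continuous. [folklore] -/
theorem continuous_dirichletSum (s : Finset ℕ) (b : ℕ → ℝ) : Continuous (dirichletSum s b) := by
  unfold dirichletSum
  fun_prop



/-! ### The smooth frequency cutoff and its lowPassKernel -/

/-- The cutoff radius actually used: `τ' = max τ 1`. [folklore] -/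
def cutoffRadius (τ : ℝ) : ℝ := max τ 1

/-- `1 ≤ τ'`. [folklore] -/
theorem one_le_cutoffRadius (τ : ℝ) : 1 ≤ cutoffRadius τ := le_max_right _ _
/-- `0 < τ'`. [folklore] -/
theorem cutoffRadius_pos (τ : ℝ) : 0 < cutoffRadius τ := one_pos.trans_le (one_le_cutoffRadius τ)

/-- Smooth bump `χ`: `= 1` on `[-τ', τ']`, supported in `(-2τ', 2τ')`, values in `[0,1]`, even
(Mathlib's `ContDiffBump`). [folklore] -/
def cutoffBump (τ : ℝ) : ContDiffBump (0 : ℝ) :=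
  ⟨cutoffRadius τ, 2 * cutoffRadius τ, cutoffRadius_pos τ, by have := cutoffRadius_pos τ; linarith⟩

/-- The cutoff `χ` as a complex-valued function. [folklore] -/
def cutoff (τ : ℝ) (ξ : ℝ) : ℂ := ((cutoffBump τ) ξ : ℂ)

/-- The cutoff is smooth. [folklore] -/
theorem cutoff_contDiff (τ : ℝ) : ContDiff ℝ (⊤ : ℕ∞) (cutoff τ) :=
  ofRealCLM.contDiff.comp (cutoffBump τ).contDiff

/-- The cutoff has compact support. [folklore] -/
theorem cutoff_hasCompactSupport (τ : ℝ) : HasCompactSupport (cutoff τ) :=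
  (cutoffBump τ).hasCompactSupport.comp_left Complex.ofReal_zero

/-- The cutoff `χ` as a Schwartz function (smooth, compactly supported). [folklore] -/
def cutoffSchwartz (τ : ℝ) : SchwartzMap ℝ ℂ :=
  (cutoff_hasCompactSupport τ).toSchwartzMap (cutoff_contDiff τ)

/-- The Schwartz cutoff is the cutoff. [folklore] -/
@[simp] theorem cutoffSchwartz_apply (τ ξ : ℝ) : cutoffSchwartz τ ξ = cutoff τ ξ := rfl

/-- The Schwartz cutoff is the cutoff (as functions). [folklore] -/
@[simp] theorem coe_cutoffSchwartz (τ : ℝ) : ⇑(cutoffSchwartz τ) = cutoff τ := rfl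

/-- The **low-pass kernel** `φ = 𝓕⁻¹ χ`, a Schwartz function. [folklore] -/
def lowPassKernelSchwartz (τ : ℝ) : SchwartzMap ℝ ℂ := 𝓕⁻ (cutoffSchwartz τ)

/-- The low-pass kernel `φ = 𝓕⁻¹ χ` as a function. [folklore] -/
def lowPassKernel (τ : ℝ) : ℝ → ℂ := ⇑(lowPassKernelSchwartz τ)

/-- `𝓕 φ = χ` (Fourier inversion on the Schwartz space). [folklore] -/
theorem fourier_lowPassKernel (τ : ℝ) : 𝓕 (lowPassKernel τ) = cutoff τ := by
  have h : 𝓕 (lowPassKernelSchwartz τ) = cutoffSchwartz τ := by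
    rw [lowPassKernelSchwartz]; exact fourier_fourierInv_eq (cutoffSchwartz τ)
  have h2 := congrArg (fun f : SchwartzMap ℝ ℂ => (f : ℝ → ℂ)) h
  simp only [SchwartzMap.fourier_coe] at h2
  funext ξ
  have := congrFun h2 ξ
  simpa [lowPassKernel] using this

/-- `φ` is integrable. [folklore] -/
theorem integrable_lowPassKernel (τ : ℝ) : Integrable (lowPassKernel τ) := (lowPassKernelSchwartz τ).integrable
/-- `φ` is continuous. [folklore] -/
theorem continuous_lowPassKernel (τ : ℝ) : Continuous (lowPassKernel τ) := (lowPassKernelSchwartz τ).continuous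

/-- `0 ≤ χ`. [folklore] -/
theorem cutoff_nonneg (τ ξ : ℝ) : 0 ≤ (cutoffBump τ) ξ := (cutoffBump τ).nonneg
/-- `χ ≤ 1`. [folklore] -/
theorem cutoff_le_one (τ ξ : ℝ) : (cutoffBump τ) ξ ≤ 1 := (cutoffBump τ).le_one
/-- `χ = 1` on `[-τ', τ']`. [folklore] -/
theorem cutoff_eq_one (τ : ℝ) {ξ : ℝ} (h : |ξ| ≤ cutoffRadius τ) : (cutoffBump τ) ξ = 1 :=
  (cutoffBump τ).one_of_mem_closedBall (by simpa [cutoffBump] using h)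
/-- `χ = 0` outside `(-2τ', 2τ')`. [folklore] -/
theorem cutoff_eq_zero (τ : ℝ) {ξ : ℝ} (h : 2 * cutoffRadius τ ≤ |ξ|) : (cutoffBump τ) ξ = 0 :=
  (cutoffBump τ).zero_of_le_dist (by simpa [cutoffBump] using h)
/-- `χ` is even. [folklore] -/
theorem cutoff_even (τ ξ : ℝ) : (cutoffBump τ) (-ξ) = (cutoffBump τ) ξ := (cutoffBump τ).neg ξ

/-- `|χ| ≤ 1_{[-2τ', 2τ']}`. [folklore] -/
theorem norm_cutoff_le_indicator (τ ξ : ℝ) :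
    ‖cutoff τ ξ‖ ≤ (Set.Icc (-(2 * cutoffRadius τ)) (2 * cutoffRadius τ)).indicator (fun _ => (1 : ℝ)) ξ := by
  rw [cutoff, Complex.norm_real, Real.norm_eq_abs, abs_of_nonneg (cutoff_nonneg τ ξ)]
  by_cases h : ξ ∈ Set.Icc (-(2 * cutoffRadius τ)) (2 * cutoffRadius τ)
  · rw [Set.indicator_of_mem h]; exact cutoff_le_one τ ξ
  · rw [Set.indicator_of_notMem h, cutoff_eq_zero]
    rw [Set.mem_Icc, not_and_or, not_le, not_le] at h
    rcases h with h | h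
    · rw [abs_of_neg (by have := cutoffRadius_pos τ; linarith)]; linarith
    · rw [abs_of_pos (by have := cutoffRadius_pos τ; linarith)]; linarith

/-- `∫ |χ| ≤ 4τ'`. [folklore] -/
theorem integral_norm_cutoff_le (τ : ℝ) : ∫ ξ, ‖cutoff τ ξ‖ ≤ 4 * cutoffRadius τ := by
  have hr := cutoffRadius_pos τ
  calc ∫ ξ, ‖cutoff τ ξ‖ ≤ ∫ ξ, (Set.Icc (-(2 * cutoffRadius τ)) (2 * cutoffRadius τ)).indicator (fun _ => (1 : ℝ)) ξ := by
        refine integral_mono_of_nonneg (Eventually.of_forall fun _ => norm_nonneg _) ?_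
          (Eventually.of_forall (norm_cutoff_le_indicator τ))
        exact (integrable_indicator_iff measurableSet_Icc).2
          (integrableOn_const (by rw [Real.volume_Icc]; exact ENNReal.ofReal_lt_top.ne))
    _ = 4 * cutoffRadius τ := by
        rw [integral_indicator measurableSet_Icc, setIntegral_const, Real.volume_real_Icc_of_le
          (by linarith), smul_eq_mul, mul_one]
        ring

/-- `‖φ(v)‖ ≤ ∫|χ| ≤ 4τ'`. [folklore] -/
theorem norm_lowPassKernel_le (τ v : ℝ) : ‖lowPassKernel τ v‖ ≤ 4 * cutoffRadius τ := by
  have : lowPassKernel τ v = 𝓕⁻ (cutoff τ) v := by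
    simp [lowPassKernel, lowPassKernelSchwartz, SchwartzMap.fourierInv_coe, coe_cutoffSchwartz]
  rw [this, Real.fourierInv_eq]
  refine (norm_integral_le_integral_norm _).trans ?_
  refine le_trans (le_of_eq ?_) (integral_norm_cutoff_le τ)
  refine integral_congr_ae (Eventually.of_forall fun ξ => ?_)
  simp only [Circle.norm_smul]

/-- The kernel as an explicit integral `φ(w) = ∫ e(wξ) χ(ξ) dξ`. [folklore] -/
theorem lowPassKernel_eq_integral (τ w : ℝ) :
    lowPassKernel τ w = ∫ ξ, Complex.exp (↑(2 * π * (w * ξ)) * Complex.I) * cutoff τ ξ := by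
  have : lowPassKernel τ w = 𝓕⁻ (cutoff τ) w := by
    simp [lowPassKernel, lowPassKernelSchwartz, SchwartzMap.fourierInv_coe, coe_cutoffSchwartz]
  rw [this, Real.fourierInv_eq']
  simp only [smul_eq_mul, RCLike.inner_apply, conj_trivial]

/-- The integrand of `φ(w)` is integrable. [folklore] -/
theorem integrable_cexp_mul_cutoff (τ w : ℝ) :
    Integrable (fun ξ => Complex.exp (↑(2 * π * (w * ξ)) * Complex.I) * cutoff τ ξ) := by
  refine (cutoffSchwartz τ).integrable.bdd_mul (c := 1) (Continuous.aestronglyMeasurable (by fun_prop)) ?_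
  exact Eventually.of_forall fun ξ => by rw [Complex.norm_exp_ofReal_mul_I]

/-- `φ` is Lipschitz with constant `16 π τ'²` (as `|e(x) - 1| ≤ 2π|x|` and `χ` lives on `|ξ| ≤ 2τ'`). [folklore] -/
theorem norm_lowPassKernel_sub_le (τ v v' : ℝ) :
    ‖lowPassKernel τ v - lowPassKernel τ v'‖ ≤ 16 * π * cutoffRadius τ ^ 2 * |v - v'| := by
  have hr := cutoffRadius_pos τ
  set D : ℝ → ℂ := fun ξ => (Complex.exp (↑(2 * π * (v * ξ)) * Complex.I)
      - Complex.exp (↑(2 * π * (v' * ξ)) * Complex.I)) * cutoff τ ξ with hD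
  have hDint : Integrable D := by
    refine (cutoffSchwartz τ).integrable.bdd_mul (c := 2) (Continuous.aestronglyMeasurable (by fun_prop)) ?_
    refine Eventually.of_forall fun ξ => (norm_sub_le _ _).trans ?_
    rw [Complex.norm_exp_ofReal_mul_I, Complex.norm_exp_ofReal_mul_I]; norm_num
  have hsub : lowPassKernel τ v - lowPassKernel τ v' = ∫ ξ, D ξ := by
    rw [lowPassKernel_eq_integral, lowPassKernel_eq_integral,
      ← integral_sub (integrable_cexp_mul_cutoff τ v) (integrable_cexp_mul_cutoff τ v')]
    refine integral_congr_ae (Eventually.of_forall fun ξ => ?_)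
    simp only [hD]; ring
  have hpt : ∀ ξ, ‖D ξ‖ ≤ (4 * π * cutoffRadius τ * |v - v'|) * ‖cutoff τ ξ‖ := by
    intro ξ
    simp only [hD]
    rw [norm_mul]
    by_cases hξ : 2 * cutoffRadius τ ≤ |ξ|
    · simp [cutoff, cutoff_eq_zero τ hξ]
    · push Not at hξ
      refine mul_le_mul_of_nonneg_right ?_ (norm_nonneg _)
      have e : Complex.exp (↑(2 * π * (v * ξ)) * Complex.I) - Complex.exp (↑(2 * π * (v' * ξ)) * Complex.I)
          = Complex.exp (↑(2 * π * (v' * ξ)) * Complex.I)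
            * (Complex.exp (Complex.I * ↑(2 * π * ξ * (v - v'))) - 1) := by
        rw [mul_sub, mul_one, ← Complex.exp_add]
        congr 2
        push_cast; ring
      rw [e, norm_mul, Complex.norm_exp_ofReal_mul_I, one_mul]
      refine norm_exp_I_mul_ofReal_sub_one_le.trans ?_
      rw [Real.norm_eq_abs, abs_mul, abs_mul, abs_mul, abs_two, abs_of_pos Real.pi_pos]
      calc 2 * π * |ξ| * |v - v'| ≤ 2 * π * (2 * cutoffRadius τ) * |v - v'| := by gcongr
        _ = 4 * π * cutoffRadius τ * |v - v'| := by ring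
  rw [hsub]
  refine (norm_integral_le_integral_norm _).trans ?_
  calc ∫ ξ, ‖D ξ‖ ≤ ∫ ξ, (4 * π * cutoffRadius τ * |v - v'|) * ‖cutoff τ ξ‖ :=
        integral_mono hDint.norm ((cutoffSchwartz τ).integrable.norm.const_mul _) hpt
    _ = (4 * π * cutoffRadius τ * |v - v'|) * ∫ ξ, ‖cutoff τ ξ‖ := integral_const_mul _ _
    _ ≤ (4 * π * cutoffRadius τ * |v - v'|) * (4 * cutoffRadius τ) :=
        mul_le_mul_of_nonneg_left (integral_norm_cutoff_le τ) (by positivity)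
    _ = 16 * π * cutoffRadius τ ^ 2 * |v - v'| := by ring


/-! ### Low and high frequency parts of the window sum -/

/-- The **low-frequency part** of the window sum, `L_θ = φ ⋆ W_θ` (so `𝓕 L_θ = χ κ_θ A`). [folklore] -/
def lowPart (s : Finset ℕ) (b : ℕ → ℝ) (τ θ : ℝ) : ℝ → ℂ :=
  lowPassKernel τ ⋆[ContinuousLinearMap.mul ℂ ℂ] logWindow s b θ

/-- The **high-frequency part** of the window sum, `H_θ = W_θ - φ ⋆ W_θ`
(so `𝓕 H_θ = (1 - χ) κ_θ A` vanishes for `|ξ| ≤ τ'`). [folklore] -/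
def highPart (s : Finset ℕ) (b : ℕ → ℝ) (τ θ : ℝ) : ℝ → ℂ :=
  fun v => logWindow s b θ v - lowPart s b τ θ v

/-- `1_{[c-θ,c)}(v - t) = 1_{(v-c, v-c+θ]}(t)`. [folklore] -/
theorem indicator_Ico_comp_sub (c θ v t : ℝ) :
    (Set.Ico (c - θ) c).indicator (1 : ℝ → ℂ) (v - t)
      = (Set.Ioc (v - c) (v - c + θ)).indicator (1 : ℝ → ℂ) t := by
  by_cases h : t ∈ Set.Ioc (v - c) (v - c + θ)
  · have h' : v - t ∈ Set.Ico (c - θ) c := by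
      rw [Set.mem_Ioc] at h; rw [Set.mem_Ico]; constructor <;> linarith
    rw [Set.indicator_of_mem h, Set.indicator_of_mem h']
    rfl
  · have h' : v - t ∉ Set.Ico (c - θ) c := by
      intro h'
      rw [Set.mem_Ico] at h'; apply h; rw [Set.mem_Ioc]; constructor <;> linarith
    rw [Set.indicator_of_notMem h, Set.indicator_of_notMem h']

/-- Explicit formula: `L(v) = ∑ b_m ∫_{v - log m}^{v - log m + θ} φ`. [folklore] -/
theorem lowPart_eq (s : Finset ℕ) (b : ℕ → ℝ) (τ : ℝ) {θ : ℝ} (hθ : 0 ≤ θ) (v : ℝ) :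
    lowPart s b τ θ v
      = ∑ m ∈ s, (b m : ℂ) * ∫ u in (v - Real.log m)..(v - Real.log m + θ), lowPassKernel τ u := by
  rw [lowPart, convolution_def]
  simp only [ContinuousLinearMap.mul_apply', logWindow, Finset.mul_sum]
  simp_rw [indicator_Ico_comp_sub]
  rw [integral_finsetSum]
  · refine Finset.sum_congr rfl fun m _ => ?_
    have e : ∀ t : ℝ, lowPassKernel τ t * ((b m : ℂ) * (Set.Ioc (v - Real.log m) (v - Real.log m + θ)).indicator 1 t)
        = (b m : ℂ) * (Set.Ioc (v - Real.log m) (v - Real.log m + θ)).indicator (lowPassKernel τ) t := by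
      intro t
      by_cases h : t ∈ Set.Ioc (v - Real.log m) (v - Real.log m + θ)
      · simp [Set.indicator_of_mem h]; ring
      · simp [Set.indicator_of_notMem h]
    simp_rw [e]
    rw [integral_const_mul, integral_indicator measurableSet_Ioc,
      intervalIntegral.integral_of_le (by linarith)]
  · intro m _
    have e : ∀ t : ℝ, lowPassKernel τ t * ((b m : ℂ) * (Set.Ioc (v - Real.log m) (v - Real.log m + θ)).indicator 1 t)
        = (b m : ℂ) * (Set.Ioc (v - Real.log m) (v - Real.log m + θ)).indicator (lowPassKernel τ) t := by
      intro t
      by_cases h : t ∈ Set.Ioc (v - Real.log m) (v - Real.log m + θ)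
      · simp [Set.indicator_of_mem h]; ring
      · simp [Set.indicator_of_notMem h]
    simp_rw [e]
    exact ((integrable_lowPassKernel τ).indicator measurableSet_Ioc).const_mul _

/-- `Ψ(v) = ∑ b_m φ(v - log m)`, the main term of the low part: `L_θ(v) = θ Ψ(v) + O(τ'² θ²)`,
**linear in `θ`** — the formal counterpart of "`((1 + h/x)^s - 1)/s = h/x + O(T₀ (h/X)²)` for
`|t| ≤ T₀`" in Matomäki–Radziwiłł's treatment of `U_j(x)`. [folklore] -/
def lowPassMain (s : Finset ℕ) (b : ℕ → ℝ) (τ : ℝ) (v : ℝ) : ℂ :=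
  ∑ m ∈ s, (b m : ℂ) * lowPassKernel τ (v - Real.log m)

/-- `‖Ψ(v)‖ ≤ 4τ' ∑|b_m|`. [folklore] -/
theorem norm_lowPassMain_le (s : Finset ℕ) (b : ℕ → ℝ) (τ v : ℝ) :
    ‖lowPassMain s b τ v‖ ≤ 4 * cutoffRadius τ * ∑ m ∈ s, |b m| := by
  unfold lowPassMain
  rw [Finset.mul_sum]
  refine (norm_sum_le _ _).trans (Finset.sum_le_sum fun m _ => ?_)
  rw [norm_mul, Complex.norm_real, Real.norm_eq_abs, mul_comm (4 * cutoffRadius τ)]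
  exact mul_le_mul_of_nonneg_left (norm_lowPassKernel_le τ _) (abs_nonneg _)

/-- `Ψ` is Lipschitz with constant `16πτ'² ∑|b_m|`. [folklore] -/
theorem norm_lowPassMain_sub_le (s : Finset ℕ) (b : ℕ → ℝ) (τ v v' : ℝ) :
    ‖lowPassMain s b τ v - lowPassMain s b τ v'‖ ≤ 16 * π * cutoffRadius τ ^ 2 * |v - v'| * ∑ m ∈ s, |b m| := by
  unfold lowPassMain
  rw [← Finset.sum_sub_distrib, Finset.mul_sum]
  refine (norm_sum_le _ _).trans (Finset.sum_le_sum fun m _ => ?_)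
  rw [← mul_sub, norm_mul, Complex.norm_real, Real.norm_eq_abs, mul_comm (16 * π * cutoffRadius τ ^ 2 * |v - v'|)]
  refine mul_le_mul_of_nonneg_left ?_ (abs_nonneg _)
  have := norm_lowPassKernel_sub_le τ (v - Real.log m) (v' - Real.log m)
  rwa [show v - Real.log m - (v' - Real.log m) = v - v' by ring] at this

/-- `∫_c^{c+θ} φ = θ φ(c) + O(8π τ'² θ²)`. [folklore] -/
theorem norm_integral_lowPassKernel_sub_le (τ c : ℝ) {θ : ℝ} (hθ : 0 ≤ θ) :
    ‖(∫ u in c..c + θ, lowPassKernel τ u) - θ * lowPassKernel τ c‖ ≤ 8 * π * cutoffRadius τ ^ 2 * θ ^ 2 := by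
  have h1 : (∫ u in c..c + θ, lowPassKernel τ u) - θ * lowPassKernel τ c = ∫ u in c..c + θ, (lowPassKernel τ u - lowPassKernel τ c) := by
    rw [intervalIntegral.integral_sub ((continuous_lowPassKernel τ).intervalIntegrable _ _)
      intervalIntegrable_const, intervalIntegral.integral_const]
    simp
  rw [h1]
  have h2 : ∀ u ∈ Set.Ioc c (c + θ), ‖lowPassKernel τ u - lowPassKernel τ c‖ ≤ 16 * π * cutoffRadius τ ^ 2 * (u - c) := by
    intro u hu
    have := norm_lowPassKernel_sub_le τ u c
    rwa [abs_of_nonneg (by linarith [hu.1])] at this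
  calc ‖∫ u in c..c + θ, (lowPassKernel τ u - lowPassKernel τ c)‖
      ≤ ∫ u in c..c + θ, 16 * π * cutoffRadius τ ^ 2 * (u - c) := by
        refine intervalIntegral.norm_integral_le_of_norm_le (by linarith) ?_ ?_
        · exact Eventually.of_forall h2
        · exact (by fun_prop : Continuous fun u => 16 * π * cutoffRadius τ ^ 2 * (u - c)).intervalIntegrable _ _
    _ = 8 * π * cutoffRadius τ ^ 2 * θ ^ 2 := by
        have hid : IntervalIntegrable (fun u : ℝ => u) volume c (c + θ) :=
          (continuous_id).intervalIntegrable _ _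
        rw [intervalIntegral.integral_const_mul, intervalIntegral.integral_sub hid
          intervalIntegrable_const, integral_id, intervalIntegral.integral_const]
        simp; ring

/-- **The low part is `θ Ψ` up to `O(τ'² θ²)`**: `‖L(v) - θ Ψ(v)‖ ≤ 8π τ'² θ² ∑|b_m|`. [folklore] -/
theorem norm_lowPart_sub_le (s : Finset ℕ) (b : ℕ → ℝ) (τ : ℝ) {θ : ℝ} (hθ : 0 ≤ θ) (v : ℝ) :
    ‖lowPart s b τ θ v - θ * lowPassMain s b τ v‖ ≤ 8 * π * cutoffRadius τ ^ 2 * θ ^ 2 * ∑ m ∈ s, |b m| := by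
  rw [lowPart_eq s b τ hθ, lowPassMain, Finset.mul_sum, ← Finset.sum_sub_distrib, Finset.mul_sum]
  refine (norm_sum_le _ _).trans (Finset.sum_le_sum fun m _ => ?_)
  rw [mul_left_comm, ← mul_sub, norm_mul, Complex.norm_real, Real.norm_eq_abs,
    mul_comm (8 * π * cutoffRadius τ ^ 2 * θ ^ 2)]
  refine mul_le_mul_of_nonneg_left ?_ (abs_nonneg _)
  have := norm_integral_lowPassKernel_sub_le τ (v - Real.log m) hθ
  exact this

/-- `‖L(v)‖ ≤ 4τ'θ ∑|b_m|`. [folklore] -/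
theorem norm_lowPart_le (s : Finset ℕ) (b : ℕ → ℝ) (τ : ℝ) {θ : ℝ} (hθ : 0 ≤ θ) (v : ℝ) :
    ‖lowPart s b τ θ v‖ ≤ 4 * cutoffRadius τ * θ * ∑ m ∈ s, |b m| := by
  rw [lowPart_eq s b τ hθ, Finset.mul_sum]
  refine (norm_sum_le _ _).trans (Finset.sum_le_sum fun m _ => ?_)
  rw [norm_mul, Complex.norm_real, Real.norm_eq_abs, mul_comm (4 * cutoffRadius τ * θ)]
  refine mul_le_mul_of_nonneg_left ?_ (abs_nonneg _)
  have := intervalIntegral.norm_integral_le_of_norm_le_const (a := v - Real.log m)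
    (b := v - Real.log m + θ) (C := 4 * cutoffRadius τ) (f := lowPassKernel τ) (fun u _ => norm_lowPassKernel_le τ u)
  calc ‖∫ u in (v - Real.log m)..(v - Real.log m + θ), lowPassKernel τ u‖ ≤ 4 * cutoffRadius τ * |v - Real.log m + θ - (v - Real.log m)| := this
    _ = 4 * cutoffRadius τ * θ := by rw [show v - Real.log m + θ - (v - Real.log m) = θ by ring, abs_of_nonneg hθ]

/-- `L` is integrable (convolution of integrable functions). [folklore] -/
theorem integrable_lowPart (s : Finset ℕ) (b : ℕ → ℝ) (τ θ : ℝ) : Integrable (lowPart s b τ θ) :=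
  (integrable_lowPassKernel τ).integrable_convolution _ (integrable_logWindow s b θ)

/-- `L` is continuous (for `θ ≥ 0`). [folklore] -/
theorem continuous_lowPart (s : Finset ℕ) (b : ℕ → ℝ) (τ : ℝ) {θ : ℝ} (hθ : 0 ≤ θ) :
    Continuous (lowPart s b τ θ) := by
  have : lowPart s b τ θ = fun v => ∑ m ∈ s, (b m : ℂ) *
      ((∫ u in (0 : ℝ)..(v - Real.log m + θ), lowPassKernel τ u) - ∫ u in (0 : ℝ)..(v - Real.log m), lowPassKernel τ u) := by
    funext v
    rw [lowPart_eq s b τ hθ]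
    refine Finset.sum_congr rfl fun m _ => ?_
    rw [intervalIntegral.integral_interval_sub_left ((continuous_lowPassKernel τ).intervalIntegrable _ _)
      ((continuous_lowPassKernel τ).intervalIntegrable _ _)]
  rw [this]
  have hprim : Continuous fun x => ∫ u in (0 : ℝ)..x, lowPassKernel τ u :=
    intervalIntegral.continuous_primitive (fun _ _ => (continuous_lowPassKernel τ).intervalIntegrable _ _) 0
  fun_prop

/-- `H` is integrable. [folklore] -/
theorem integrable_highPart (s : Finset ℕ) (b : ℕ → ℝ) (τ θ : ℝ) : Integrable (highPart s b τ θ) :=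
  (integrable_logWindow s b θ).sub (integrable_lowPart s b τ θ)

/-- `H ∈ L²`. [folklore] -/
theorem memLp_two_highPart (s : Finset ℕ) (b : ℕ → ℝ) (τ : ℝ) {θ : ℝ} (hθ : 0 ≤ θ) :
    MemLp (highPart s b τ θ) 2 := by
  refine memLp_two_of_norm_le (integrable_highPart s b τ θ)
    (M := (∑ m ∈ s, |b m|) + 4 * cutoffRadius τ * θ * ∑ m ∈ s, |b m|) fun v => ?_
  exact (norm_sub_le _ _).trans (add_le_add (norm_logWindow_le s b θ v) (norm_lowPart_le s b τ hθ v))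

/-- `𝓕 (f - g) = 𝓕 f - 𝓕 g` for integrable `f, g : ℝ → ℂ`. [folklore] -/
theorem fourier_sub {f g : ℝ → ℂ} (hf : Integrable f) (hg : Integrable g) (ξ : ℝ) :
    𝓕 (fun v => f v - g v) ξ = 𝓕 f ξ - 𝓕 g ξ := by
  simp only [Real.fourier_real_eq_integral_exp_smul, smul_eq_mul, mul_sub]
  exact integral_sub (integrable_cexp_mul hf ξ) (integrable_cexp_mul hg ξ)

/-- **Fourier transform of the high part**: `𝓕 H = (1 - χ) κ_θ A` (convolution theorem). [folklore] -/
theorem fourier_highPart (s : Finset ℕ) (b : ℕ → ℝ) (τ : ℝ) {θ : ℝ} (hθ : 0 ≤ θ) (ξ : ℝ) :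
    𝓕 (highPart s b τ θ) ξ = (1 - cutoff τ ξ) * (windowTransform θ ξ * dirichletSum s b ξ) := by
  unfold highPart
  rw [fourier_sub (integrable_logWindow s b θ) (integrable_lowPart s b τ θ), lowPart,
    Real.fourier_mul_convolution_eq (integrable_lowPassKernel τ) (integrable_logWindow s b θ),
    fourier_lowPassKernel, fourier_logWindow s b hθ]
  ring

/-- **Plancherel for the high part**: `∫ |H|² = ∫ |(1-χ) κ_θ A|²` (Plancherel on `L¹ ∩ L²`,
`Literature/Analysis/FunctionSpaces/PlancherelL1L2.lean`). [folklore] -/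
theorem integral_norm_sq_highPart (s : Finset ℕ) (b : ℕ → ℝ) (τ : ℝ) {θ : ℝ} (hθ : 0 ≤ θ) :
    ∫ v, ‖highPart s b τ θ v‖ ^ 2
      = ∫ ξ, ‖(1 - cutoff τ ξ) * (windowTransform θ ξ * dirichletSum s b ξ)‖ ^ 2 := by
  rw [← Literature.Analysis.FunctionSpaces.integral_norm_sq_fourierIntegral_eq (integrable_highPart s b τ θ)
    (memLp_two_highPart s b τ hθ)]
  refine integral_congr_ae (Eventually.of_forall fun ξ => ?_)
  simp only [fourier_highPart s b τ hθ]

/-! ### The frequency-side bound -/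

/-- The radial majorant `F(r) = 1_{r ≥ τ'} min(Θ², 1/(π² r²)) |A(r)|²` of `|𝓕 H_θ|²`. [folklore] -/
def freqMajorant (s : Finset ℕ) (b : ℕ → ℝ) (τ Θ : ℝ) (r : ℝ) : ℝ :=
  (Set.Ici (cutoffRadius τ)).indicator (fun r => min (Θ ^ 2) (1 / (π ^ 2 * r ^ 2)) * ‖dirichletSum s b r‖ ^ 2) r

/-- The majorant is nonnegative. [folklore] -/
theorem freqMajorant_nonneg (s : Finset ℕ) (b : ℕ → ℝ) (τ Θ r : ℝ) : 0 ≤ freqMajorant s b τ Θ r := by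
  unfold freqMajorant
  refine Set.indicator_nonneg (fun r _ => mul_nonneg (le_min (sq_nonneg _) ?_) (sq_nonneg _)) r
  positivity

/-- The majorant is measurable. [folklore] -/
theorem measurable_freqMajorant (s : Finset ℕ) (b : ℕ → ℝ) (τ Θ : ℝ) :
    Measurable (freqMajorant s b τ Θ) := by
  unfold freqMajorant
  refine Measurable.indicator ?_ measurableSet_Ici
  refine Measurable.mul (Measurable.min measurable_const ?_) ?_
  · exact measurable_const.div (measurable_const.mul (measurable_id.pow_const 2))
  · exact (continuous_dirichletSum s b).norm.measurable.pow_const 2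

/-- Pointwise: `‖𝓕H(ξ)‖² ≤ F(|ξ|)` when `0 ≤ θ ≤ Θ` (`χ = 1` on `|ξ| ≤ τ'`, `|1 - χ| ≤ 1`,
the two bounds for `κ_θ`, and `|A(-ξ)| = |A(ξ)|`). [folklore] -/
theorem norm_sq_fourier_highPart_le (s : Finset ℕ) (b : ℕ → ℝ) (τ : ℝ) {θ Θ : ℝ} (hθ : 0 ≤ θ)
    (hθΘ : θ ≤ Θ) (ξ : ℝ) :
    ‖(1 - cutoff τ ξ) * (windowTransform θ ξ * dirichletSum s b ξ)‖ ^ 2 ≤ freqMajorant s b τ Θ |ξ| := by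
  unfold freqMajorant
  by_cases hξ : |ξ| < cutoffRadius τ
  · have h1 : cutoff τ ξ = 1 := by
      rw [cutoff, cutoff_eq_one τ hξ.le]; simp
    rw [h1, sub_self, zero_mul, norm_zero, Set.indicator_of_notMem (by simpa using hξ)]
    simp
  · push Not at hξ
    rw [Set.indicator_of_mem (Set.mem_Ici.2 hξ)]
    have hξ0 : ξ ≠ 0 := by
      intro h; rw [h, abs_zero] at hξ; linarith [cutoffRadius_pos τ]
    have hA : ‖dirichletSum s b |ξ|‖ = ‖dirichletSum s b ξ‖ := by
      rcases le_or_gt 0 ξ with h | h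
      · rw [abs_of_nonneg h]
      · rw [abs_of_neg h, norm_dirichletSum_neg]
    rw [hA, norm_mul, norm_mul, mul_pow, mul_pow]
    have hc : ‖1 - cutoff τ ξ‖ ≤ 1 := by
      rw [cutoff, ← Complex.ofReal_one, ← Complex.ofReal_sub, Complex.norm_real, Real.norm_eq_abs,
        abs_of_nonneg (by linarith [cutoff_le_one τ ξ])]
      linarith [cutoff_nonneg τ ξ]
    have hwindowTransform : ‖windowTransform θ ξ‖ ^ 2 ≤ min (Θ ^ 2) (1 / (π ^ 2 * |ξ| ^ 2)) := by
      refine le_min ?_ ?_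
      · exact pow_le_pow_left₀ (norm_nonneg _) ((norm_windowTransform_le ξ hθ).trans hθΘ) 2
      · have := norm_windowTransform_le_inv θ hξ0
        calc ‖windowTransform θ ξ‖ ^ 2 ≤ (1 / (π * |ξ|)) ^ 2 := pow_le_pow_left₀ (norm_nonneg _) this 2
          _ = 1 / (π ^ 2 * |ξ| ^ 2) := by rw [div_pow, one_pow, mul_pow]
    have hc2 : ‖1 - cutoff τ ξ‖ ^ 2 ≤ 1 := by
      calc ‖1 - cutoff τ ξ‖ ^ 2 ≤ 1 ^ 2 := pow_le_pow_left₀ (norm_nonneg _) hc 2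
        _ = 1 := one_pow 2
    calc ‖1 - cutoff τ ξ‖ ^ 2 * (‖windowTransform θ ξ‖ ^ 2 * ‖dirichletSum s b ξ‖ ^ 2)
        ≤ 1 * (min (Θ ^ 2) (1 / (π ^ 2 * |ξ| ^ 2)) * ‖dirichletSum s b ξ‖ ^ 2) :=
          mul_le_mul hc2 (mul_le_mul_of_nonneg_right hwindowTransform (sq_nonneg _)) (by positivity) zero_le_one
      _ = _ := one_mul _

/-- The majorant is integrable (it is `≤ 2 (∑|b_m|)² (1 + ξ²)⁻¹`). [folklore] -/
theorem integrable_freqMajorant_abs (s : Finset ℕ) (b : ℕ → ℝ) (τ Θ : ℝ) :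
    Integrable (fun ξ : ℝ => freqMajorant s b τ Θ |ξ|) := by
  set β := ∑ m ∈ s, |b m| with hβ
  have hmeas : AEStronglyMeasurable (fun ξ : ℝ => freqMajorant s b τ Θ |ξ|) volume :=
    ((measurable_freqMajorant s b τ Θ).comp continuous_abs.measurable).aestronglyMeasurable
  refine (integrable_inv_one_add_sq.const_mul (2 * β ^ 2)).mono' hmeas ?_
  refine Eventually.of_forall fun ξ => ?_
  rw [Real.norm_eq_abs, abs_of_nonneg (freqMajorant_nonneg _ _ _ _ _)]
  unfold freqMajorant
  by_cases hξ : |ξ| ∈ Set.Ici (cutoffRadius τ)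
  · rw [Set.indicator_of_mem hξ]
    rw [Set.mem_Ici] at hξ
    have h1 : 1 ≤ |ξ| := (one_le_cutoffRadius τ).trans hξ
    have hξ2 : 1 ≤ ξ ^ 2 := by nlinarith [sq_abs ξ, abs_nonneg ξ]
    have hA : ‖dirichletSum s b |ξ|‖ ^ 2 ≤ β ^ 2 :=
      pow_le_pow_left₀ (norm_nonneg _) (norm_dirichletSum_le s b _) 2
    have hmin : min (Θ ^ 2) (1 / (π ^ 2 * |ξ| ^ 2)) ≤ 2 * (1 + ξ ^ 2)⁻¹ := by
      refine (min_le_right _ _).trans ?_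
      have hπ : (1 : ℝ) ≤ π ^ 2 := by nlinarith [Real.pi_gt_three]
      rw [sq_abs, ← div_eq_mul_inv, div_le_div_iff₀ (by positivity) (by positivity)]
      nlinarith
    calc min (Θ ^ 2) (1 / (π ^ 2 * |ξ| ^ 2)) * ‖dirichletSum s b |ξ|‖ ^ 2
        ≤ (2 * (1 + ξ ^ 2)⁻¹) * β ^ 2 :=
          mul_le_mul hmin hA (sq_nonneg _) (by positivity)
      _ = 2 * β ^ 2 * (1 + ξ ^ 2)⁻¹ := by ring
  · rw [Set.indicator_of_notMem hξ]
    positivity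

/-- **High-frequency energy bound** (Plancherel + the kernel bounds): for `0 ≤ θ ≤ Θ`,
`∫ |H_θ|² ≤ 2 ∫_{ξ > τ'} min(Θ², 1/(π²ξ²)) |A(ξ)|² dξ`. This is the formal core of the "Parseval"
step in the proof of Lemma 14 of Matomäki–Radziwiłł. [cite: MatomakiRadziwillAnnals2016, §7, proof of Lemma 14] -/
theorem integral_norm_sq_highPart_le (s : Finset ℕ) (b : ℕ → ℝ) (τ : ℝ) {θ Θ : ℝ} (hθ : 0 ≤ θ)
    (hθΘ : θ ≤ Θ) :
    ∫ v, ‖highPart s b τ θ v‖ ^ 2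
      ≤ 2 * ∫ ξ in Set.Ioi (cutoffRadius τ), min (Θ ^ 2) (1 / (π ^ 2 * ξ ^ 2)) * ‖dirichletSum s b ξ‖ ^ 2 := by
  rw [integral_norm_sq_highPart s b τ hθ]
  calc ∫ ξ, ‖(1 - cutoff τ ξ) * (windowTransform θ ξ * dirichletSum s b ξ)‖ ^ 2
      ≤ ∫ ξ, freqMajorant s b τ Θ |ξ| :=
        integral_mono_of_nonneg (Eventually.of_forall fun ξ => sq_nonneg _)
          (integrable_freqMajorant_abs s b τ Θ)
          (Eventually.of_forall (norm_sq_fourier_highPart_le s b τ hθ hθΘ))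
    _ = 2 * ∫ ξ in Set.Ioi (0 : ℝ), freqMajorant s b τ Θ ξ := integral_comp_abs
    _ = 2 * ∫ ξ in Set.Ioi (cutoffRadius τ), min (Θ ^ 2) (1 / (π ^ 2 * ξ ^ 2)) * ‖dirichletSum s b ξ‖ ^ 2 := by
        congr 1
        have : (fun ξ => freqMajorant s b τ Θ ξ) = (Set.Ici (cutoffRadius τ)).indicator
            (fun r => min (Θ ^ 2) (1 / (π ^ 2 * r ^ 2)) * ‖dirichletSum s b r‖ ^ 2) := rfl
        rw [this, setIntegral_indicator measurableSet_Ici,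
          show Set.Ioi (0 : ℝ) ∩ Set.Ici (cutoffRadius τ) = Set.Ici (cutoffRadius τ) from
            Set.inter_eq_right.2 (fun ξ hξ => (cutoffRadius_pos τ).trans_le hξ),
          integral_Ici_eq_integral_Ioi]


/-! ### Joint measurability in `(θ, v)` -/

/-- `(θ, v) ↦ W_θ(v)` is jointly measurable. [folklore] -/
theorem measurable_uncurry_logWindow (s : Finset ℕ) (b : ℕ → ℝ) :
    Measurable (fun p : ℝ × ℝ => logWindow s b p.1 p.2) := by
  unfold logWindow
  refine Finset.measurable_sum _ fun m _ => Measurable.const_mul ?_ _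
  have : (fun p : ℝ × ℝ => (Set.Ico (Real.log m - p.1) (Real.log m)).indicator (1 : ℝ → ℂ) p.2)
      = ({p : ℝ × ℝ | Real.log m - p.1 ≤ p.2} ∩ {p : ℝ × ℝ | p.2 < Real.log m}).indicator 1 := by
    funext p
    by_cases h : p.2 ∈ Set.Ico (Real.log m - p.1) (Real.log m)
    · rw [Set.indicator_of_mem h, Set.indicator_of_mem]
      · rfl
      · exact ⟨h.1, h.2⟩
    · rw [Set.indicator_of_notMem h, Set.indicator_of_notMem]
      intro h'
      exact h ⟨h'.1, h'.2⟩
  rw [this]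
  refine measurable_const.indicator (MeasurableSet.inter ?_ ?_)
  · exact measurableSet_le (by fun_prop) (by fun_prop)
  · exact measurableSet_lt (by fun_prop) (by fun_prop)

/-- `W_θ = 0` for `θ < 0` (empty windows). [folklore] -/
theorem logWindow_of_neg (s : Finset ℕ) (b : ℕ → ℝ) {θ : ℝ} (hθ : θ < 0) : logWindow s b θ = 0 := by
  funext v
  unfold logWindow
  simp only [Pi.zero_apply]
  refine Finset.sum_eq_zero fun m _ => ?_
  rw [Set.Ico_eq_empty (by linarith), Set.indicator_empty]
  simp

/-- `L_θ = 0` for `θ < 0`. [folklore] -/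
theorem lowPart_of_neg (s : Finset ℕ) (b : ℕ → ℝ) (τ : ℝ) {θ : ℝ} (hθ : θ < 0) :
    lowPart s b τ θ = 0 := by
  rw [lowPart, logWindow_of_neg s b hθ, convolution_zero]

/-- The low part as a globally defined piecewise-continuous expression in `(θ, v)`. [folklore] -/
theorem lowPart_eq_ite (s : Finset ℕ) (b : ℕ → ℝ) (τ θ v : ℝ) :
    lowPart s b τ θ v = if 0 ≤ θ then ∑ m ∈ s, (b m : ℂ) *
      ((∫ u in (0 : ℝ)..(v - Real.log m + θ), lowPassKernel τ u) - ∫ u in (0 : ℝ)..(v - Real.log m), lowPassKernel τ u)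
      else 0 := by
  split_ifs with h
  · rw [lowPart_eq s b τ h]
    refine Finset.sum_congr rfl fun m _ => ?_
    rw [intervalIntegral.integral_interval_sub_left ((continuous_lowPassKernel τ).intervalIntegrable _ _)
      ((continuous_lowPassKernel τ).intervalIntegrable _ _)]
  · rw [lowPart_of_neg s b τ (lt_of_not_ge h)]; rfl

/-- `(θ, v) ↦ L_θ(v)` is jointly measurable. [folklore] -/
theorem measurable_uncurry_lowPart (s : Finset ℕ) (b : ℕ → ℝ) (τ : ℝ) :
    Measurable (fun p : ℝ × ℝ => lowPart s b τ p.1 p.2) := by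
  have hprim : Continuous fun x => ∫ u in (0 : ℝ)..x, lowPassKernel τ u :=
    intervalIntegral.continuous_primitive (fun _ _ => (continuous_lowPassKernel τ).intervalIntegrable _ _) 0
  have e : (fun p : ℝ × ℝ => lowPart s b τ p.1 p.2) = fun p : ℝ × ℝ => if 0 ≤ p.1 then
      ∑ m ∈ s, (b m : ℂ) * ((∫ u in (0 : ℝ)..(p.2 - Real.log m + p.1), lowPassKernel τ u)
        - ∫ u in (0 : ℝ)..(p.2 - Real.log m), lowPassKernel τ u) else 0 := by
    funext p; exact lowPart_eq_ite s b τ p.1 p.2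
  rw [e]
  refine Measurable.ite (measurableSet_le measurable_const measurable_fst) ?_ measurable_const
  refine Finset.measurable_sum _ fun m _ => Measurable.const_mul (Measurable.sub ?_ ?_) _
  · exact hprim.measurable.comp (by fun_prop)
  · exact hprim.measurable.comp (by fun_prop)

/-- `(θ, v) ↦ H_θ(v)` is jointly measurable (for Tonelli in the proof of Lemma 14). [folklore] -/
theorem measurable_uncurry_highPart (s : Finset ℕ) (b : ℕ → ℝ) (τ : ℝ) :
    Measurable (fun p : ℝ × ℝ => highPart s b τ p.1 p.2) :=
  (measurable_uncurry_logWindow s b).sub (measurable_uncurry_lowPart s b τ)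

/-- `H_θ` is measurable. [folklore] -/
theorem measurable_highPart (s : Finset ℕ) (b : ℕ → ℝ) (τ θ : ℝ) : Measurable (highPart s b τ θ) := by
  have h := (measurable_uncurry_highPart s b τ).comp
    ((measurable_const (a := θ)).prodMk measurable_id : Measurable fun v : ℝ => (θ, v))
  exact h

/-- `‖H_θ(v)‖ ≤ (1 + 4τ'Θ) ∑|b_m|` for `0 ≤ θ ≤ Θ`. [folklore] -/
theorem norm_highPart_le (s : Finset ℕ) (b : ℕ → ℝ) (τ : ℝ) {θ Θ : ℝ} (hθ : 0 ≤ θ) (hθΘ : θ ≤ Θ)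
    (v : ℝ) : ‖highPart s b τ θ v‖ ≤ (1 + 4 * cutoffRadius τ * Θ) * ∑ m ∈ s, |b m| := by
  unfold highPart
  refine (norm_sub_le _ _).trans ?_
  have h1 := norm_logWindow_le s b θ v
  have h2 := norm_lowPart_le s b τ hθ v
  have hβ : 0 ≤ ∑ m ∈ s, |b m| := Finset.sum_nonneg fun _ _ => abs_nonneg _
  have h3 : 4 * cutoffRadius τ * θ * ∑ m ∈ s, |b m| ≤ 4 * cutoffRadius τ * Θ * ∑ m ∈ s, |b m| := by
    have := cutoffRadius_pos τ; gcongr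
  linarith


end Literature.NumberTheory.LFunctions.WindowPlancherel
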